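import Summits.Langlands.Langlands.Theorems.PicardMuOrdinaryMuOrdinaryFamilyRTThornePointGalois
import Summits.Langlands.Langlands.Theorems.PicardMuOrdinaryMuOrdinaryFamilyRTThorneArithmeticPoints
import Summits.Langlands.Langlands.Theorems.PicardMuOrdinaryMuOrdinaryFamilyRTThorneAuxiliaryFieldLemmas
import Literature.NumberTheory.GaloisRepresentations.ResidualHypothesesVSplit
import HarnessLib

/-!
# Crux `MuOrdinaryFamilyRT` (stmt-Langlands-13757), line `thorne-minimal-lift`:
# leaf `pointRep_absIrreducible_restrictField` — the point representations stay absolutely irreducible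
# on every `Γ_L` on which the heart keeps its image (PROVED)

Leaf P1 of wave 4 (glue for `stub_pointAutomorphic`): Thorne's minimal automorphy lifting theorem is applied
to `ρ_y|Γ_L` for the point representation `ρ_y = y ∘ 𝓕.ρ` (`pointRep 𝓕 y`) of a family `𝓕 : OrdFamily f ι e S₀ ρ_C`
at an integral `ℚ̄₃`-point `y`, over auxiliary fields `L ⊇ F' ⊇ K = ℚ(ζ₃)` chosen so that the residual heart
`r̄ = r̄_f^B : Γ_K → GL₃(𝔽₃)` KEEPS ITS IMAGE on `Γ_L`: `r̄(res_K^L Γ_L) = r̄(Γ_K)`.  This file proves that under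
exactly this hypothesis `ρ_y|Γ_L` is absolutely irreducible, generalizing the landed `stub_pointGalois`
(…ThornePointGalois: `L = F'` quadratic, by Clifford) by running its Burnside route along an arbitrary
continuous homomorphism `φ : Γ' → Γ_K`:

* § 1 ranges kept along homomorphisms (pure group theory): `(r ∘ φ)(Γ') = r(Γ)` iff `r(Γ) ≤ (r ∘ φ)(Γ')`;
  stability under replacing `φ` by a conjugate `γ φ γ⁻¹` and under shortening a composite `φ ∘ χ ↝ φ`.
* § 2 **Burnside form along `φ`** (`hasAbsolutelyIrreducibleReduction_pointRep_comp`): `ρ_y ∘ φ` is integral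
  in the identity frame (`‖y r‖ ≤ 1`), and the nine elements `s_a ∈ Γ_K` whose reductions `r̄(s_a)` form a
  basis of `M₃(𝔽₃)` (`exists_isUnit_entries_rbar`, from `FreeSeedSmoothRt.rbarAbsIrreducible` + Burnside) lift
  to `t_a ∈ Γ'` with `r̄(φ t_a) = r̄(s_a)` because the image is kept; the entry matrix of the `𝓕.ρ(φ t_a)` reduces
  under `𝓕.π` to that invertible matrix, so its determinant is a unit of the local ring `R` and has norm one
  under `y`.  Hence `ρ_y ∘ φ` is absolutely irreducible (`HasAbsolutelyIrreducibleReduction.isAbsolutelyIrreducible`),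
  and residually `r̄ ∘ φ` is absolutely irreducible (`IsAbsIrreducible.comp_of_range_le`).
* § 3 the registered leaf `pointRep_absIrreducible_restrictField` (`φ = res_K^L = absGaloisRestrict K L`) and
  its residual companion `isAbsIrreducible_rbar_comp_absGaloisRestrict`.
* § 4 **towers** `K ⊆ F' ⊆ L` (`IsScalarTower K F' L`): the chosen restriction maps satisfy
  `res_K^{F'} ∘ res_{F'}^L = γ (res_K^L) γ⁻¹` (`exists_absGaloisRestrict_comp_eq_conj`), so the image is kept
  over `L` along `res_K^L` iff it is kept along `res_K^{F'} ∘ res_{F'}^L`, and then it is kept over `F'`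
  (`range_rbar_comp_absGaloisRestrict_of_tower`); consequently `ρ_y|Γ_{F'}`, `ρ_y|Γ_L` and `(ρ_y|Γ_{F'})|Γ_L`
  are all absolutely irreducible (`pointRep_absIrreducible_restrictField_tower`).  If `F'` itself keeps the
  image, "kept over `L`" is equivalent to "`r̄|Γ_{F'}` keeps its image along `res_{F'}^L`"
  (`range_rbar_comp_absGaloisRestrict_eq_iff_of_tower`) — the form a field `L/F'` avoiding the kernel field
  of `r̄|Γ_{F'}` delivers.
* § 5 **quadratic base** `F' = K(√d)`, `disc f ∉ F'²`, `disc f ∉ ℚ² ∪ -3ℚ²`: the image is kept on `Γ_{F'}`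
  (`range_rbar_comp_absGaloisRestrict`, …ThorneAuxiliaryFieldLemmas), whence the corollaries
  `pointRep_absIrreducible_restrictField_quadratic` (over `F'`, and over any `L/F'` along which `r̄|Γ_{F'}`
  keeps its image).

No named fact, no definition; continuity of `y` is not needed (only integrality `‖y r‖ ≤ 1`).
-/

set_option linter.dupNamespace false -- `Summit.Langlands.Langlands.…` is the problem's namespace

namespace Summit.Langlands.Langlands.Cruxes.MuOrdinaryFamilyRT.ThorneMinimalLift

open scoped NumberField Polynomial Matrix Classical
open Field IsDedekindDomain Polynomial
open Literature.NumberTheory.GaloisRepresentations Literature.NumberTheory.Automorphic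
open Summit.Langlands.Langlands.Cruxes.MuOrdinaryFamilyRT.CharZeroDominance

noncomputable section

variable {f : ℤ[X]} {ι : PadicAlgCl 3 ≃+* ℂ} {e : K →+* ℂ} {S₀ : Finset (HeightOneSpectrum (𝓞 K))}
  {ρC : FramedGaloisRep K (PadicAlgCl 3) 3}

/-! ## 1. Ranges kept along a homomorphism -/

section Ranges

variable {G G' G'' H : Type*} [Group G] [Group G'] [Group G''] [Group H]

/-- The image of `r ∘ φ` is always contained in the image of `r`. -/
theorem range_comp_le_range (r : G →* H) (φ : G' →* G) : (r.comp φ).range ≤ r.range := by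
  rw [MonoidHom.range_comp]
  exact Subgroup.map_le_range _ _

/-- `r ∘ φ` has the same image as `r` iff the image of `r` is contained in that of `r ∘ φ`. -/
theorem range_comp_eq_iff (r : G →* H) (φ : G' →* G) :
    (r.comp φ).range = r.range ↔ r.range ≤ (r.comp φ).range :=
  ⟨fun h => h.ge, fun h => le_antisymm (range_comp_le_range r φ) h⟩

/-- Keeping the image of `r` is stable under replacing `φ` by a pointwise conjugate `σ ↦ γ φ(σ) γ⁻¹`. -/
theorem range_le_range_comp_of_forall_eq_conj (r : G →* H) {φ ψ : G' →* G} (γ : G)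
    (h : ∀ σ, ψ σ = γ * φ σ * γ⁻¹) (hφ : r.range ≤ (r.comp φ).range) : r.range ≤ (r.comp ψ).range := by
  rintro _ ⟨g, rfl⟩
  obtain ⟨τ, hτ⟩ := hφ ⟨γ⁻¹ * g * γ, rfl⟩
  refine ⟨τ, ?_⟩
  simp only [MonoidHom.comp_apply] at hτ ⊢
  rw [h, map_mul, map_mul, hτ, ← map_mul, ← map_mul]
  congr 1
  group

/-- If the image of `r` is kept along a composite `φ ∘ χ`, it is kept along `φ`. -/
theorem range_le_range_comp_of_comp (r : G →* H) (φ : G' →* G) (χ : G'' →* G')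
    (h : r.range ≤ (r.comp (φ.comp χ)).range) : r.range ≤ (r.comp φ).range := by
  refine h.trans ?_
  rw [← MonoidHom.comp_assoc]
  exact range_comp_le_range _ _

end Ranges

/-! ## 2. The Burnside form along a homomorphism keeping the residual image -/

/-- **Nine elements of `Γ'` whose residual images along `φ` form a basis of `M₃(𝔽₃)`**: the nine elements
`s_a ∈ Γ_K` of `exists_isUnit_entries_rbar` lift along `φ` on the level of `r̄`-values, because the image of
`r̄` is kept. -/
theorem exists_isUnit_entries_rbar_comp (hgen : Generic f) (B : Module.Basis (Fin 3) (ZMod 3) (Heart 3 (Roots f)))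
    {Γ' : Type*} [Group Γ'] (φ : Γ' →* absoluteGaloisGroup K)
    (hφ : (rbar f B).range ≤ ((rbar f B).comp φ).range) :
    ∃ t : Fin 3 × Fin 3 → Γ',
      IsUnit (Matrix.of fun c d : Fin 3 × Fin 3 => (rbar f B (φ (t c))).val d.1 d.2) := by
  obtain ⟨s, hunit⟩ := exists_isUnit_entries_rbar hgen B
  have h : ∀ c, ∃ t : Γ', rbar f B (φ t) = rbar f B (s c) := fun c => by
    obtain ⟨t, ht⟩ := hφ ⟨s c, rfl⟩
    exact ⟨t, ht⟩
  choose t ht using h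
  refine ⟨t, ?_⟩
  simp_rw [ht]
  exact hunit

/-- **Burnside form from nine good elements.**  If `ρ' : Γ' → GL₃(ℚ̄₃)` is `ρ_y ∘ ψ` for a map `ψ : Γ' → Γ_K`
and an integral point `y`, and the residual images `r̄(ψ t_a)` of nine elements `t_a ∈ Γ'` form a basis of
`M₃(𝔽₃)`, then `ρ'` has absolutely irreducible reduction in the identity frame: the entry matrix of the
`𝓕.ρ (ψ t_a)` reduces under `𝓕.π` to an invertible matrix (`𝓕.residual`), so its determinant lies outside
`ker π = 𝔪_R`, is a unit, and has norm one under `y`. -/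
theorem hasAbsolutelyIrreducibleReduction_of_isUnit_entries (𝓕 : OrdFamily f ι e S₀ ρC)
    (y : 𝓕.R →+* PadicAlgCl 3) (hy : ∀ r : 𝓕.R, ‖y r‖ ≤ 1)
    {Γ' : Type*} [Group Γ'] [TopologicalSpace Γ'] (ψ : Γ' → absoluteGaloisGroup K)
    (ρ' : FramedRep Γ' (PadicAlgCl 3) 3) (hρ' : ∀ g, ρ' g = pointRep 𝓕 y (ψ g))
    (t : Fin 3 × Fin 3 → Γ')
    (hunit : IsUnit (Matrix.of fun c d : Fin 3 × Fin 3 => (rbar f 𝓕.B (ψ (t c))).val d.1 d.2)) :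
    FramedRep.HasAbsolutelyIrreducibleReduction ρ' := by
  -- adapted from `hasAbsolutelyIrreducibleReduction_pointRep` (…ThornePointGalois), `s c ↝ ψ (t c)`
  obtain ⟨D, hD⟩ : ∃ D : Matrix (Fin 3 × Fin 3) (Fin 3 × Fin 3) 𝓕.R,
      D = Matrix.of fun c d : Fin 3 × Fin 3 => (𝓕.ρ (ψ (t c))).val d.1 d.2 := ⟨_, rfl⟩
  have hDmap : 𝓕.π.mapMatrix D =
      Matrix.of fun c d : Fin 3 × Fin 3 => (rbar f 𝓕.B (ψ (t c))).val d.1 d.2 := by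
    ext c d
    rw [AlgHom.mapMatrix_apply, Matrix.map_apply, hD, Matrix.of_apply, Matrix.of_apply]
    exact congrArg (fun A : Matrix (Fin 3) (Fin 3) (ZMod 3) => A d.1 d.2) (𝓕.residual (ψ (t c)))
  have hπdet : 𝓕.π D.det ≠ 0 := by
    rw [AlgHom.map_det, hDmap]
    exact ((Matrix.isUnit_iff_isUnit_det _).1 hunit).ne_zero
  obtain ⟨u, hu⟩ := isUnit_of_map_ne_zero 𝓕 hπdet
  refine ⟨1, t, fun σ i j => ?_, ?_⟩
  · rw [one_mul, inv_one, mul_one, hρ']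
    exact hy _
  · have hmat : (Matrix.of fun c d : Fin 3 × Fin 3 =>
        ((1 * ρ' (t c) * 1⁻¹ : GL (Fin 3) (PadicAlgCl 3)) : Matrix (Fin 3) (Fin 3) (PadicAlgCl 3)) d.1 d.2) =
        y.mapMatrix D := by
      ext c d
      rw [Matrix.of_apply, one_mul, inv_one, mul_one, hρ', RingHom.mapMatrix_apply, Matrix.map_apply, hD,
        Matrix.of_apply]
      rfl
    rw [hmat, ← RingHom.map_det, ← hu]
    exact norm_map_unit_eq_one 𝓕 y hy u

/-- **Burnside form along a homomorphism keeping the residual image.**  For generic `f`, an integral point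
`y` and a continuous `φ : Γ' → Γ_K` with `r̄(Γ_K) ≤ r̄(φ Γ')`, the pulled-back point representation `ρ_y ∘ φ`
has absolutely irreducible reduction. -/
theorem hasAbsolutelyIrreducibleReduction_pointRep_comp (𝓕 : OrdFamily f ι e S₀ ρC) (hgen : Generic f)
    {Γ' : Type*} [Group Γ'] [TopologicalSpace Γ'] (φ : Γ' →ₜ* absoluteGaloisGroup K)
    (hφ : (rbar f 𝓕.B).range ≤ ((rbar f 𝓕.B).comp φ.toMonoidHom).range)
    (y : 𝓕.R →+* PadicAlgCl 3) (hy : ∀ r : 𝓕.R, ‖y r‖ ≤ 1)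
    (ρy : FramedGaloisRep K (PadicAlgCl 3) 3) (hρy : ∀ g, ρy g = pointRep 𝓕 y g) :
    FramedRep.HasAbsolutelyIrreducibleReduction (ρy.comp φ) := by
  obtain ⟨t, hunit⟩ := exists_isUnit_entries_rbar_comp hgen 𝓕.B φ.toMonoidHom hφ
  exact hasAbsolutelyIrreducibleReduction_of_isUnit_entries 𝓕 y hy φ (ρy.comp φ)
    (fun g => by rw [ContinuousMonoidHom.comp_toFun]; exact hρy _) t hunit

/-- **`ρ_y ∘ φ` is absolutely irreducible** whenever `φ : Γ' → Γ_K` keeps the image of the heart. -/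
theorem isAbsolutelyIrreducible_pointRep_comp (𝓕 : OrdFamily f ι e S₀ ρC) (hgen : Generic f)
    {Γ' : Type*} [Group Γ'] [TopologicalSpace Γ'] (φ : Γ' →ₜ* absoluteGaloisGroup K)
    (hφ : (rbar f 𝓕.B).range ≤ ((rbar f 𝓕.B).comp φ.toMonoidHom).range)
    (y : 𝓕.R →+* PadicAlgCl 3) (hy : ∀ r : 𝓕.R, ‖y r‖ ≤ 1)
    (ρy : FramedGaloisRep K (PadicAlgCl 3) 3) (hρy : ∀ g, ρy g = pointRep 𝓕 y g) :
    FramedRep.IsAbsolutelyIrreducible (ρy.comp φ) :=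
  FramedRep.HasAbsolutelyIrreducibleReduction.isAbsolutelyIrreducible (by norm_num : 0 < 3)
    (hasAbsolutelyIrreducibleReduction_pointRep_comp 𝓕 hgen φ hφ y hy ρy hρy)

/-- **Residual companion**: `r̄ ∘ φ` is absolutely irreducible whenever `φ` keeps the image of `r̄`
(`FreeSeedSmoothRt.rbarAbsIrreducible` + `IsAbsIrreducible.comp_of_range_le`). -/
theorem isAbsIrreducible_rbar_comp (hgen : Generic f) (B : Module.Basis (Fin 3) (ZMod 3) (Heart 3 (Roots f)))
    {Γ' : Type*} [Group Γ'] (φ : Γ' →* absoluteGaloisGroup K)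
    (hφ : (rbar f B).range ≤ ((rbar f B).comp φ).range) : IsAbsIrreducible ((rbar f B).comp φ) :=
  (FreeSeedSmoothRt.rbarAbsIrreducible f B hgen).comp_of_range_le φ hφ

/-! ## 3. Restriction to an extension field keeping the image of the heart -/

/-- **`pointRep_absIrreducible_restrictField` (registered leaf, PROVED).**  For generic `f`, a family `𝓕`,
ANY extension field `L` of `K` on which the heart keeps its image (`r̄(res_K^L Γ_L) = r̄(Γ_K)`), an integral
`ℚ̄₃`-point `y` of `𝓕.R` and any framing `ρy` of `pointRep 𝓕 y`, the restriction `ρy|Γ_L` is absolutely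
irreducible: Burnside form along `res_K^L` (`hasAbsolutelyIrreducibleReduction_pointRep_comp`), then
`HasAbsolutelyIrreducibleReduction.isAbsolutelyIrreducible`. -/
theorem pointRep_absIrreducible_restrictField : ∀ (f : ℤ[X]) (ι : PadicAlgCl 3 ≃+* ℂ) (e : K →+* ℂ) (S₀ : Finset (HeightOneSpectrum (𝓞 K))) (ρC : FramedGaloisRep K (PadicAlgCl 3) 3) (𝓕 : OrdFamily f ι e S₀ ρC), Generic f → ∀ (L : Type) [Field L] [Algebra K L], ((rbar f 𝓕.B).comp (absGaloisRestrict K L).toMonoidHom).range = (rbar f 𝓕.B).range → ∀ (y : 𝓕.R →+* PadicAlgCl 3), (∀ r : 𝓕.R, ‖y r‖ ≤ 1) → ∀ ρy : FramedGaloisRep K (PadicAlgCl 3) 3, (∀ g, ρy g = pointRep 𝓕 y g) → FramedRep.IsAbsolutelyIrreducible (ρy.restrictField L) := by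
  intro f ι e S₀ ρC 𝓕 hgen L _ _ hL y hy ρy hρy
  exact isAbsolutelyIrreducible_pointRep_comp 𝓕 hgen (absGaloisRestrict K L)
    ((range_comp_eq_iff _ _).1 hL) y hy ρy hρy

/-- Burnside form of the restriction `ρy|Γ_L` (same hypotheses). -/
theorem hasAbsolutelyIrreducibleReduction_pointRep_restrictField (𝓕 : OrdFamily f ι e S₀ ρC) (hgen : Generic f)
    (L : Type*) [Field L] [Algebra K L]
    (hL : ((rbar f 𝓕.B).comp (absGaloisRestrict K L).toMonoidHom).range = (rbar f 𝓕.B).range)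
    (y : 𝓕.R →+* PadicAlgCl 3) (hy : ∀ r : 𝓕.R, ‖y r‖ ≤ 1)
    (ρy : FramedGaloisRep K (PadicAlgCl 3) 3) (hρy : ∀ g, ρy g = pointRep 𝓕 y g) :
    FramedRep.HasAbsolutelyIrreducibleReduction (ρy.restrictField L) :=
  hasAbsolutelyIrreducibleReduction_pointRep_comp 𝓕 hgen (absGaloisRestrict K L)
    ((range_comp_eq_iff _ _).1 hL) y hy ρy hρy

/-- **Residual companion over `L`**: `r̄ ∘ res_K^L` is absolutely irreducible when `L` keeps the image. -/
theorem isAbsIrreducible_rbar_comp_absGaloisRestrict (hgen : Generic f)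
    (B : Module.Basis (Fin 3) (ZMod 3) (Heart 3 (Roots f))) (L : Type*) [Field L] [Algebra K L]
    (hL : ((rbar f B).comp (absGaloisRestrict K L).toMonoidHom).range = (rbar f B).range) :
    IsAbsIrreducible ((rbar f B).comp (absGaloisRestrict K L).toMonoidHom) :=
  isAbsIrreducible_rbar_comp hgen B _ ((range_comp_eq_iff _ _).1 hL)

/-! ## 4. Towers `K ⊆ F' ⊆ L` -/

section Tower

variable (B : Module.Basis (Fin 3) (ZMod 3) (Heart 3 (Roots f)))
  (F' L : Type*) [Field F'] [Field L] [Algebra K F'] [Algebra K L] [Algebra F' L] [IsScalarTower K F' L]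

/-- Along a tower the image is kept along `res_K^L` iff it is kept along `res_K^{F'} ∘ res_{F'}^L`
(the two maps are conjugate by a fixed `γ ∈ Γ_K`, `exists_absGaloisRestrict_comp_eq_conj`). -/
theorem range_rbar_comp_comp_eq_iff :
    ((rbar f B).comp ((absGaloisRestrict K F').toMonoidHom.comp (absGaloisRestrict F' L).toMonoidHom)).range =
        (rbar f B).range ↔
      ((rbar f B).comp (absGaloisRestrict K L).toMonoidHom).range = (rbar f B).range := by
  obtain ⟨γ, hγ⟩ := exists_absGaloisRestrict_comp_eq_conj K F' L
  rw [range_comp_eq_iff, range_comp_eq_iff]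
  constructor
  · refine range_le_range_comp_of_forall_eq_conj (rbar f B) γ⁻¹ fun σ => ?_
    simp only [MonoidHom.comp_apply, ContinuousMonoidHom.coe_toMonoidHom, MonoidHom.coe_coe, hγ, inv_inv]
    group
  · refine range_le_range_comp_of_forall_eq_conj (rbar f B) γ fun σ => ?_
    simp only [MonoidHom.comp_apply, ContinuousMonoidHom.coe_toMonoidHom, MonoidHom.coe_coe, hγ]

/-- **Kept over `L` ⟹ kept over `F'`** for a tower `K ⊆ F' ⊆ L`. -/
theorem range_rbar_comp_absGaloisRestrict_of_tower
    (hL : ((rbar f B).comp (absGaloisRestrict K L).toMonoidHom).range = (rbar f B).range) :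
    ((rbar f B).comp (absGaloisRestrict K F').toMonoidHom).range = (rbar f B).range := by
  rw [range_comp_eq_iff]
  exact range_le_range_comp_of_comp (rbar f B) _ (absGaloisRestrict F' L).toMonoidHom
    ((range_comp_eq_iff _ _).1 ((range_rbar_comp_comp_eq_iff B F' L).2 hL))

/-- If `F'` keeps the image, then `L` keeps it iff `r̄|Γ_{F'}` keeps ITS image along `res_{F'}^L`
(the shape delivered by an `L/F'` avoiding the kernel field of `r̄|Γ_{F'}`). -/
theorem range_rbar_comp_absGaloisRestrict_eq_iff_of_tower
    (hF' : ((rbar f B).comp (absGaloisRestrict K F').toMonoidHom).range = (rbar f B).range) :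
    ((rbar f B).comp (absGaloisRestrict K L).toMonoidHom).range = (rbar f B).range ↔
      (((rbar f B).comp (absGaloisRestrict K F').toMonoidHom).comp (absGaloisRestrict F' L).toMonoidHom).range =
        ((rbar f B).comp (absGaloisRestrict K F').toMonoidHom).range := by
  rw [← range_rbar_comp_comp_eq_iff B F' L, hF', MonoidHom.comp_assoc]

end Tower

/-- **Absolute irreducibility along a tower** `K ⊆ F' ⊆ L` keeping the image over `L`: `ρ_y|Γ_{F'}`,
`ρ_y|Γ_L` and the iterated restriction `(ρ_y|Γ_{F'})|Γ_L` are absolutely irreducible. -/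
theorem pointRep_absIrreducible_restrictField_tower : ∀ (f : ℤ[X]) (ι : PadicAlgCl 3 ≃+* ℂ) (e : K →+* ℂ) (S₀ : Finset (HeightOneSpectrum (𝓞 K))) (ρC : FramedGaloisRep K (PadicAlgCl 3) 3) (𝓕 : OrdFamily f ι e S₀ ρC), Generic f → ∀ (F' L : Type) [Field F'] [Field L] [Algebra K F'] [Algebra K L] [Algebra F' L] [IsScalarTower K F' L], ((rbar f 𝓕.B).comp (absGaloisRestrict K L).toMonoidHom).range = (rbar f 𝓕.B).range → ∀ (y : 𝓕.R →+* PadicAlgCl 3), (∀ r : 𝓕.R, ‖y r‖ ≤ 1) → ∀ ρy : FramedGaloisRep K (PadicAlgCl 3) 3, (∀ g, ρy g = pointRep 𝓕 y g) → FramedRep.IsAbsolutelyIrreducible (ρy.restrictField F') ∧ FramedRep.IsAbsolutelyIrreducible (ρy.restrictField L) ∧ FramedRep.IsAbsolutelyIrreducible ((ρy.restrictField F').restrictField L) := by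
  intro f ι e S₀ ρC 𝓕 hgen F' L _ _ _ _ _ _ hL y hy ρy hρy
  refine ⟨pointRep_absIrreducible_restrictField f ι e S₀ ρC 𝓕 hgen F'
      (range_rbar_comp_absGaloisRestrict_of_tower 𝓕.B F' L hL) y hy ρy hρy,
    pointRep_absIrreducible_restrictField f ι e S₀ ρC 𝓕 hgen L hL y hy ρy hρy, ?_⟩
  have h2 := (range_comp_eq_iff _ _).1 ((range_rbar_comp_comp_eq_iff 𝓕.B F' L).2 hL)
  exact isAbsolutelyIrreducible_pointRep_comp 𝓕 hgen ((absGaloisRestrict K F').comp (absGaloisRestrict F' L))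
    h2 y hy ρy hρy

/-! ## 5. The quadratic base `F' = K(√d)` -/

/-- **Over the quadratic auxiliary field and its image-keeping extensions.**  For generic `f` with
`disc f ∉ ℚ² ∪ -3ℚ²` (the `MainClass` clauses: `Γ_K ↠ S₄`), a quadratic number field `F'/K` with `disc f ∉ F'²`
keeps the image of the heart (`range_rbar_comp_absGaloisRestrict`); so `ρ_y|Γ_{F'}` is absolutely irreducible,
and for every further extension `L/F'` along which `r̄|Γ_{F'}` keeps its image, so are `ρ_y|Γ_L` and
`(ρ_y|Γ_{F'})|Γ_L`. -/
theorem pointRep_absIrreducible_restrictField_quadratic : ∀ (f : ℤ[X]) (ι : PadicAlgCl 3 ≃+* ℂ) (e : K →+* ℂ) (S₀ : Finset (HeightOneSpectrum (𝓞 K))) (ρC : FramedGaloisRep K (PadicAlgCl 3) 3) (𝓕 : OrdFamily f ι e S₀ ρC), Generic f → ¬ IsSquare (f.map (Int.castRingHom ℚ)).discr → ¬ IsSquare ((-3 : ℚ) * (f.map (Int.castRingHom ℚ)).discr) → ∀ (F' : Type) [Field F'] [NumberField F'] [Algebra K F'], Module.finrank K F' = 2 → ¬ IsSquare ((f.discr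 : ℤ) : F') → ∀ (y : 𝓕.R →+* PadicAlgCl 3), (∀ r : 𝓕.R, ‖y r‖ ≤ 1) → ∀ ρy : FramedGaloisRep K (PadicAlgCl 3) 3, (∀ g, ρy g = pointRep 𝓕 y g) → FramedRep.IsAbsolutelyIrreducible (ρy.restrictField F') ∧ ∀ (L : Type) [Field L] [Algebra K L] [Algebra F' L] [IsScalarTower K F' L], (((rbar f 𝓕.B).comp (absGaloisRestrict K F').toMonoidHom).comp (absGaloisRestrict F' L).toMonoidHom).range = ((rbar f 𝓕.B).comp (absGaloisRestrict K F').toMonoidHom).range → FramedRep.IsAbsolutelyIrreducible (ρy.restrictField L) ∧ FramedRep.IsAbsolutelyIrreducible ((ρy.restrictField F').restrictField L) := by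
  intro f ι e S₀ ρC 𝓕 hgen hD hD3 F' _ _ _ h2 hF' y hy ρy hρy
  have hkept : ((rbar f 𝓕.B).comp (absGaloisRestrict K F').toMonoidHom).range = (rbar f 𝓕.B).range :=
    range_rbar_comp_absGaloisRestrict hgen hD hD3 F' h2 hF' 𝓕.B
  refine ⟨pointRep_absIrreducible_restrictField f ι e S₀ ρC 𝓕 hgen F' hkept y hy ρy hρy, ?_⟩
  intro L _ _ _ _ hL
  have hL' : ((rbar f 𝓕.B).comp (absGaloisRestrict K L).toMonoidHom).range = (rbar f 𝓕.B).range :=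
    (range_rbar_comp_absGaloisRestrict_eq_iff_of_tower 𝓕.B F' L hkept).2 hL
  exact (pointRep_absIrreducible_restrictField_tower f ι e S₀ ρC 𝓕 hgen F' L hL' y hy ρy hρy).2

end

end Summit.Langlands.Langlands.Cruxes.MuOrdinaryFamilyRT.ThorneMinimalLift
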